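import Summits.QuantumFields.YangMills.Theorems.UnitScaleTiltProp7ComplementarySourceWeighted
import Summits.QuantumFields.YangMills.Theorems.UnitScaleTiltProp7GaugeProjectorBlockPackagePin
import Summits.QuantumFields.YangMills.Theorems.UnitScaleTiltProp7PcolPin
import HarnessLib

/-!
# Route `UnitScaleTilt`, crux K1 «MinimiserStabilityRegPr» (stmt-QuantumFields-19200), EX row `h88` (S47), CHAIR LOCATE №41 letter (src-κ) — **THE (src-κ) PIN:
# ✓`Prop7ComplementarySourceWeighted.hsrcW_of_P3v` AT ★p1's PINNED COARSE WEIGHT `c₁ := c₀·(L³)^{K−n}` WITH EVERY P3v ∕ B2c LETTER DISCHARGED FROM `RegPr`** — column slope `μ(am)`,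
# Gram slope `μ′(am) = min (μ∕4) (m_B(am)∕(3Γ(am)))`, WEIGHT RATE `δ₁(am) := μ′(am)∕2` (= W5a ✓`Prop7GaugeProjectorBlockPackagePin`'s rate, so the (c4)-PIN feeds `hGw`∕`hDw`∕`hSw` to
# ★p1 g28's ✓`hc4w_of_letters` at ONE `κ`), constant `Sw(am)` CLOSED and MEMBER-FREE (no `K`, `n`, `|T³|`): the `hSw` letter of the (c4w) knit at one member, conditional on NOTHING but `RegPr`
# and the LOD data of record (width seat `ym3-torus-px13` gen 16; road = px5 ✓`hPw_pin` ∕ ✓`hPcol_pin` verbatim).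

Cell `ym3-torus` (HUMAN RULING D-0037; rung R3 = SU(2) YM₃ on T³ — NOT d = 4, NOT infinite volume, NOT a mass gap, NOT Clay).  THEOREMS ONLY (0 `def`, 0 `sorry`);
`--supports stmt-QuantumFields-19200 --as helper`; count-neutral.

THE PIN (★p1 g25∕g26; px5 g12–g14 precedent).  At `c₁ := c₀(L³)^{K−n}` the raw letters are numbers: `(25∕8)·c₁ℓ⁻³∕c₀ = 25∕8`, `max 2 (16c₀ℓ³∕(am·c₁)) = max 2 (16∕am)`,
`m_B = 2∕((1 + 25∕8)(600(27∕4)⁶ + am))`; the column window holds at `μ(am) = 1∕(10√(max 2 (16∕am))·√(27 + 2025am∕8))` (✓`window_delta`, ✓`window_win`), the Gram window∕gap at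
`μ′(am) ≤ μ∕4` (✓`gap_nonneg`, ✓`gap_le`, ✓`window_gap`: `(m_B²∕2 − 3ε(μ′)²)⁻¹ ≤ 6∕m_B²`; `e^{9μ′} ≤ 3` ✓`exp_nine_mul_le_three`), the operator rows ✓`norm_lift_topMean_le` ∕ ✓`norm_massive_inverse_le` ∕
✓`coarseGram_coercive` (read at the closed `m_B(am)`), the column VALUE decay `hcol` ⟸ V5b ✓`hcol_of_massiveColumn_decay` (rate `(min μ ¼)∕2`) with its constant closed by the leaves ✓`unitA_pin`∕✓`unitU1_pin`∕
✓`unitU3_pin` (`C_pt(am)` = W5a's closed column constant), and P3v's lift∕column product `A_T·c₀(√c₁)⁻¹ℓ³ = 5∕2` (✓`Prop7PcolPin.AT_mul_Cc_eq`).  The rate `δ₁ = μ′∕2` sits below both engine rates of (src-κ)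
(`(min μ ¼)∕2` and `μ′`), so its two convolution volumes are the closed `(2(1+1∕((min μ ¼)∕2 − δ₁)))³`, `4(2(1+1∕(μ′ − δ₁)))³`.

WHAT IS PROVED (ns `Summit.QuantumFields.YangMills.Theorems.Prop7ComplementarySourceWeightedPin`; member `F`, `n < K`; LOD letters `Q″ hseq` displayed VERBATIM as in W5a; the LOD data
`ι hι T hT G hAG` at the pin with mass `0 < am`).
* `sw_le_aux` (real monotonicity for the source constant).
* ★★★ `hsrcW_pin` — **the (src-κ) letter `hSw` at the pin, rate `δ₁(am)`, CLOSED constant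
  `Sw(am) = 10·(18∕m_B(am)²)·4(2(1+1∕(μ′−δ₁)))³·(C_pt(am)·(2(1+1∕((min μ ¼)∕2 − δ₁)))³)`** in ★p1 g28's (c4w)-LETTERS `hSw` binder shape (W4's fibre currency) at P3v §1's source map
  `c = fun v => Σ_i λ_i(v)•b_i` (so `hsrcid` is ✓`sub_projR_eq_G_lift_coeffSum` by `exact`).
HYP-SAT (★★OWNER RULING №42).  As W5a: `RegPr` is the face's class (`10⁷L³ε₀ ≤ 1`); `hseq` ⟸ ✓`exists_intertwiner_of_regPr` (iv); `ι` by `rfl`, `T := (ιQ″)†`, `G hAG` ⟸ ✓`exists_massive_inverse` —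
the member-of-Lift ∕ Idx editions discharge them as W6∕W7 do; NO Lift letter, NO window, NO `hcol` is displayed here.  The conclusion is an explicit decayed row with a member-free constant; no `Prop` placeholder.
HONEST SCOPE.  Bookkeeping + real arithmetic over landed rows; nothing of (c4w), the h88-DOOR, `hPcol`, the eight EX rows, EX `stub_existenceMinimalOrbit`, `MinimiserStabilityRegPr` (19200) or R3 is proved here;
the Yang–Mills mass gap is NOT proved.

References: T. Bałaban, CMP **99** (1985) 389–434 [Balaban1985BackgroundPropagators] ((3.11) p.392, (3.21)–(3.25) p.394, Thm 3.1 (3.42)∕(3.46) pp.397–398, (3.49) p.399, Thm 3.11 p.416);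
CMP **102** (1985) 277–309 [Balaban1985Variational] ((88) p.291, (138)–(139) p.299); CMP **116** (1988) 1–22 [Balaban1988RG2Cluster] ((2.7) p.13).
-/

set_option autoImplicit false

noncomputable section

open scoped BigOperators Matrix.Norms.L2Operator InnerProductSpace ComplexConjugate Matrix

namespace Summit.QuantumFields.YangMills.Theorems.Prop7ComplementarySourceWeightedPin

open Literature.MathematicalPhysics.QuantumFieldTheory.Balaban1983to89
open Literature.MathematicalPhysics.QuantumFieldTheory.Balaban1983to89.T3ContinuumYM3Torus
open T4Continuum BlockAveraging
open BlockAveraging (Idx)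
open B7Prop1Explicit (disp)
open B5Eq118OneStroke (iterBlockOf)
open B10Eq27TorusAxialLog (holT transl)
open B7TransferAnalyticMean (meanCLM)
open B4Sect5Torus (TSite)
open B9Eq311L2Pairing (WL2)
open B11Eq103H1Complex (SiteL2K BondL2K projR)
open Summit.QuantumFields.YangMills.Theorems.Prop8Chart (emlIterU)
open T3SectALandauChart (eta eta_pos bgUnits)
open T3PrintedRegularMinimiser (RegPr)
open T3PrintedRegularOrbits (sites_eq)
open T3LevelShift (siteShift)
open Summit.QuantumFields.YangMills.Theorems.Prop7SectET3Transport (periodsT3 siteEquiv bondEquiv)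
open Summit.QuantumFields.YangMills.Theorems.Prop7SectET3HilbertLetters (W₂ frobEquiv toL2 toL2S DL2 DstarL2 covLapSite)
open Summit.QuantumFields.YangMills.Theorems.Prop7SiteEntryCoordinates (orthonormal_spike top_le_span_spike)
open Summit.QuantumFields.YangMills.Theorems.Prop7LODSlotK2WindowLetters (window_delta window_win gap_nonneg gap_le window_gap)
open Summit.QuantumFields.YangMills.Theorems.Prop7ComplementaryProjectorBlockDecay (norm_lift_topMean_le norm_massive_inverse_le coarseCoercivity_pos)
open Summit.QuantumFields.YangMills.Theorems.Prop7CoarseGramCoercivity (coarseGram_coercive)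
open Summit.QuantumFields.YangMills.Theorems.Prop7KernelRow349Pin (exp_nine_mul_le_three)
open Summit.QuantumFields.YangMills.Theorems.Prop7CurvedMemberGradientRowPin (unitA_pin unitU1_pin unitU3_pin)
open Summit.QuantumFields.YangMills.Theorems.Prop7ComplementaryProjectorPointwiseDecayClosed (hcol_of_massiveColumn_decay)
open Summit.QuantumFields.YangMills.Theorems.Prop7PcolPin (AT_mul_Cc_eq)
open Summit.QuantumFields.YangMills.Theorems.Prop7ComplementarySourceWeighted (hsrcW_of_P3v)

variable (F : T3Family) {n K : ℕ} (h : n ≤ K) {c₀ : ℝ} [Fact (0 < c₀)]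
  {ε₀ : ℝ} (hε₀ : 0 < ε₀) (hε7 : 10 ^ 7 * (F.L : ℝ) ^ 3 * ε₀ ≤ 1)
  (U₀ : GaugeField (F.P K) 0 (Matrix.specialUnitaryGroup (Fin 2) ℂ)) (hreg : RegPr F n K ε₀ U₀)
  (Q'' : SiteL2K ℂ 3 (periodsT3 F K) c₀ W₂ →ₗ[ℂ] (Site (F.P K) (K - n) → Matrix (Fin 2) (Fin 2) ℂ))
  (hseq : ∀ lam : Site (F.P K) 0 → Matrix (Fin 2) (Fin 2) ℂ, ∃ ns : (j : ℕ) → Site (F.P K) j → Matrix (Fin 2) (Fin 2) ℂ, ns 0 = lam ∧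
      (∀ (j : ℕ) (y : Site (F.P K) (j + 1)), ns (j + 1) y = ns j (emb y) - meanCLM (Idx (F.P K)) (Matrix (Fin 2) (Fin 2) ℂ) fun i : Idx (F.P K) =>
        ns j (emb y) - ((holT (emlIterU j (bgUnits F K U₀)) (emb y) (stairWord i.2.1 (off i.1)) : (Matrix (Fin 2) (Fin 2) ℂ)ˣ) : Matrix (Fin 2) (Fin 2) ℂ) *
          ns j (transl (emb y) (disp (stairWord i.2.1 (off i.1)))) * (((holT (emlIterU j (bgUnits F K U₀)) (emb y) (stairWord i.2.1 (off i.1)))⁻¹ : (Matrix (Fin 2) (Fin 2) ℂ)ˣ) : Matrix (Fin 2) (Fin 2) ℂ)) ∧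
      ns (K - n) = Q'' (toL2S F K c₀ lam))

/-! ## §0 A real monotonicity step for the source constant -/

/-- `4·AT·(((INV·E9)·Cc)·F4) ≤ 4·AT·(((I′·3)·Cc)·F4)` for `0 ≤ AT, Cc, F4`, `0 ≤ INV ≤ I′`, `0 ≤ E9 ≤ 3`. [folklore] -/
theorem sw_le_aux {AT INV E9 F4 Cc I' : ℝ} (hAT : 0 ≤ AT) (hI0 : 0 ≤ INV) (hI : INV ≤ I') (hE0 : 0 ≤ E9) (hE : E9 ≤ 3) (hF4 : 0 ≤ F4) (hCc : 0 ≤ Cc) :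
    4 * AT * (((INV * E9) * Cc) * F4) ≤ 4 * AT * (((I' * 3) * Cc) * F4) := by
  have hI' : 0 ≤ I' := hI0.trans hI
  gcongr

/-! ## §1 ★★★ The (src-κ) letter at the pin -/

include hε₀ hε7 hreg hseq in
-- HEARTBEAT rule (README): the statement carries W5a's closed column constant and the closed Gram slope; budgeted decl-locally (disclosed), as ✓`hPw_pin`.
set_option maxHeartbeats 400000 in
/-- ★★★ **THE (src-κ) LETTER AT THE PIN — `‖(T c(v))(x)‖ ≤ Sw(am)·V_b·e^{−δ₁(am)·tdist(B x, z)}`** for every site source with `‖v(x)‖ ≤ V_b·e^{−δ₁(am)·tdist(B x, z)}`, at `c₁ := c₀(L³)^{K−n}`,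
LOD mass `0 < am`, `c = Σ_i λ_i(·)•b_i` (P3v §1), rate `δ₁(am) = μ′(am)∕2`, `Sw(am) = 10·(18∕m_B²)·4(2(1+1∕(μ′−δ₁)))³·(C_pt(am)·(2(1+1∕((min μ ¼)∕2 − δ₁)))³)` (closed, member-free):
✓`hsrcW_of_P3v` with every P3v∕B2c letter discharged from `RegPr` by W5a ✓`hPw_pin`'s road. [cite: Balaban1985BackgroundPropagators, Thm 3.1 (3.42)∕(3.46) pp.397–398, (3.49) p.399; Balaban1985Variational, (139) p.299; Balaban1988RG2Cluster, (2.7) p.13] -/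
theorem hsrcW_pin (hnK : n < K) {am : ℝ} (ham : 0 < am) [hc₁ : Fact (0 < (c₀ * ((F.L : ℝ) ^ 3) ^ (K - n)))]
    (ι : (Site (F.P K) (K - n) → Matrix (Fin 2) (Fin 2) ℂ) →ₗ[ℂ] SiteL2K ℂ 3 (periodsT3 F n) (c₀ * ((F.L : ℝ) ^ 3) ^ (K - n)) W₂)
    (hι : ∀ c, ι c = toL2S F n (c₀ * ((F.L : ℝ) ^ 3) ^ (K - n)) (fun z => c (siteShift (sites_eq F n K h) z)))
    (T : SiteL2K ℂ 3 (periodsT3 F n) (c₀ * ((F.L : ℝ) ^ 3) ^ (K - n)) W₂ →ₗ[ℂ] SiteL2K ℂ 3 (periodsT3 F K) c₀ W₂)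
    (hT : ∀ (l : SiteL2K ℂ 3 (periodsT3 F K) c₀ W₂) (f : SiteL2K ℂ 3 (periodsT3 F n) (c₀ * ((F.L : ℝ) ^ 3) ^ (K - n)) W₂), ⟪ι (Q'' l), f⟫_ℂ = ⟪l, T f⟫_ℂ)
    (G : SiteL2K ℂ 3 (periodsT3 F K) c₀ W₂ →ₗ[ℂ] SiteL2K ℂ 3 (periodsT3 F K) c₀ W₂)
    (hAG : ∀ f, covLapSite F n K c₀ U₀ (G f) + (am : ℂ) • T (ι (Q'' (G f))) = f) :
    ∀ (v : SiteL2K ℂ 3 (periodsT3 F K) c₀ W₂) (z : Site (F.P K) (K - n)) (Vb : ℝ),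
      (∀ x : Site (F.P K) 0, ‖WL2.equiv ℂ _ W₂ v (siteEquiv F K x)‖ ≤ Vb * Real.exp (-((min ((1 / (10 * Real.sqrt (max 2 (16 / am)) * Real.sqrt (27 + 2025 / 8 * am))) / 4) ((2 / ((1 + 25 / 8) * (600 * (27 / 4 : ℝ) ^ 6 + am))) / (3 * (Real.sqrt (max 2 (16 / am)) * (2 + Real.sqrt (max 2 (16 / am))) * (3 * Real.sqrt 3 + 27 + 9 * Real.sqrt am * Real.sqrt (25 / 8) + 81 * am * (25 / 8)) * (8 * Real.sqrt (max 2 (16 / am)) + 8 * Real.sqrt (max 2 (16 / am)) ^ 2) * (10 * Real.sqrt (25 / 8)) + 9 * (max 2 (16 / am)) * Real.sqrt (25 / 8))))) / 2 * (Site.tdist (P := F.P K) (iterBlockOf (K - n) x) z : ℝ)))) →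
      ∀ x : Site (F.P K) 0,
        ‖WL2.equiv ℂ _ W₂ (T ((fun v => ∑ i, (∑ i', (Matrix.of fun i i' : Site (F.P n) 0 × (Fin 2 × Fin 2) => ⟪G (T ((OrthonormalBasis.mk (orthonormal_spike F) (top_le_span_spike F) : OrthonormalBasis (Site (F.P n) 0 × (Fin 2 × Fin 2)) ℂ (SiteL2K ℂ 3 (periodsT3 F n) (c₀ * ((F.L : ℝ) ^ 3) ^ (K - n)) W₂)) i)), G (T ((OrthonormalBasis.mk (orthonormal_spike F) (top_le_span_spike F) : OrthonormalBasis (Site (F.P n) 0 × (Fin 2 × Fin 2)) ℂ (SiteL2K ℂ 3 (periodsT3 F n) (c₀ * ((F.L : ℝ) ^ 3) ^ (K - n)) W₂)) i'))⟫_ℂ)⁻¹ i i' * ⟪G (T ((OrthonormalBasis.mk (orthonormal_spike F) (top_le_span_spike F) : OrthonormalBasis (Site (F.P n) 0 × (Fin 2 × Fin 2)) ℂ (SiteL2K ℂ 3 (periodsT3 F n) (c₀ * ((F.L : ℝ) ^ 3) ^ (K - n)) W₂)) i')), v⟫_ℂ) • (OrthonormalBasis.mk (orthonormal_spike F) (top_le_span_spike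 F) : OrthonormalBasis (Site (F.P n) 0 × (Fin 2 × Fin 2)) ℂ (SiteL2K ℂ 3 (periodsT3 F n) (c₀ * ((F.L : ℝ) ^ 3) ^ (K - n)) W₂)) i) v)) (siteEquiv F K x)‖
          ≤ (10 * (18 / (2 / ((1 + 25 / 8) * (600 * (27 / 4 : ℝ) ^ 6 + am))) ^ 2) * (4 * (2 * (1 + 1 / (min ((1 / (10 * Real.sqrt (max 2 (16 / am)) * Real.sqrt (27 + 2025 / 8 * am))) / 4) ((2 / ((1 + 25 / 8) * (600 * (27 / 4 : ℝ) ^ 6 + am))) / (3 * (Real.sqrt (max 2 (16 / am)) * (2 + Real.sqrt (max 2 (16 / am))) * (3 * Real.sqrt 3 + 27 + 9 * Real.sqrt am * Real.sqrt (25 / 8) + 81 * am * (25 / 8)) * (8 * Real.sqrt (max 2 (16 / am)) + 8 * Real.sqrt (max 2 (16 / am)) ^ 2) * (10 * Real.sqrt (25 / 8)) + 9 * (max 2 (16 / am)) * Real.sqrt (25 / 8)))) - (min ((1 / (10 * Real.sqrt (max 2 (16 / am)) * Real.sqrt (27 + 2025 / 8 * am))) / 4) ((2 / ((1 + 25 /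 8) * (600 * (27 / 4 : ℝ) ^ 6 + am))) / (3 * (Real.sqrt (max 2 (16 / am)) * (2 + Real.sqrt (max 2 (16 / am))) * (3 * Real.sqrt 3 + 27 + 9 * Real.sqrt am * Real.sqrt (25 / 8) + 81 * am * (25 / 8)) * (8 * Real.sqrt (max 2 (16 / am)) + 8 * Real.sqrt (max 2 (16 / am)) ^ 2) * (10 * Real.sqrt (25 / 8)) + 9 * (max 2 (16 / am)) * Real.sqrt (25 / 8))))) / 2))) ^ 3) * (((14 * (8 * Real.exp (3 * min (1 / (10 * Real.sqrt (max 2 (16 / am)) * Real.sqrt (27 + 2025 / 8 * am))) (1 / 4)) * ((5 / 2 : ℝ) + Real.exp (3 * (1 / (10 * Real.sqrt (max 2 (16 / am)) * Real.sqrt (27 + 2025 / 8 * am)))) * ((am * (5 / 2) * (25 / 8) * (8 * max 2 (16 / am))))))) + (Real.sqrt 432 * (Real.sqrt (8 * Real.exp (3 * min (1 / (10 * Real.sqrt (max 2 (16 / am)) * Real.sqrt (27 + 2025 / 8 * am))) (1 / 4)) * Real.exp (6 * (1 / (10 * Real.sqrt (max 2 (16 / am)) * Real.sqrt (27 + 2025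 / 8 * am)))) * (2 * (1 + 1 / (1 / (10 * Real.sqrt (max 2 (16 / am)) * Real.sqrt (27 + 2025 / 8 * am))))) ^ 3) * ((8 * max 2 (16 / am)) * Real.sqrt (25 / 8))))) * (2 * (1 + 1 / (min (1 / (10 * Real.sqrt (max 2 (16 / am)) * Real.sqrt (27 + 2025 / 8 * am))) (1 / 4) / 2 - (min ((1 / (10 * Real.sqrt (max 2 (16 / am)) * Real.sqrt (27 + 2025 / 8 * am))) / 4) ((2 / ((1 + 25 / 8) * (600 * (27 / 4 : ℝ) ^ 6 + am))) / (3 * (Real.sqrt (max 2 (16 / am)) * (2 + Real.sqrt (max 2 (16 / am))) * (3 * Real.sqrt 3 + 27 + 9 * Real.sqrt am * Real.sqrt (25 / 8) + 81 * am * (25 / 8)) * (8 * Real.sqrt (max 2 (16 / am)) + 8 * Real.sqrt (max 2 (16 / am)) ^ 2) * (10 * Real.sqrt (25 / 8)) + 9 * (max 2 (16 / am)) * Real.sqrt (25 / 8))))) / 2))) ^ 3)) * Vb * Real.exp (-((min ((1 / (10 * Real.sqrt (max 2 (16 / am)) * Real.sqrt (27 + 2025 / 8 * am))) / 4) ((2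 / ((1 + 25 / 8) * (600 * (27 / 4 : ℝ) ^ 6 + am))) / (3 * (Real.sqrt (max 2 (16 / am)) * (2 + Real.sqrt (max 2 (16 / am))) * (3 * Real.sqrt 3 + 27 + 9 * Real.sqrt am * Real.sqrt (25 / 8) + 81 * am * (25 / 8)) * (8 * Real.sqrt (max 2 (16 / am)) + 8 * Real.sqrt (max 2 (16 / am)) ^ 2) * (10 * Real.sqrt (25 / 8)) + 9 * (max 2 (16 / am)) * Real.sqrt (25 / 8))))) / 2 * (Site.tdist (P := F.P K) (iterBlockOf (K - n) x) z : ℝ))) := by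
  have hc₀ : 0 < c₀ := Fact.out
  have hc₁ : 0 < c₀ * ((F.L : ℝ) ^ 3) ^ (K - n) := hc₁.out
  have hL1 : (1 : ℝ) < F.L := by exact_mod_cast F.hL.2
  have hL0 : (0 : ℝ) < F.L := by linarith only [hL1]
  have hLP := (F.P K).L_pos
  -- ★p1's pin `c₁ := c₀(L³)^(K−n)`: the raw letters are K-free numbers
  have hsx : (25 / 8) * ((c₀ * ((F.L : ℝ) ^ 3) ^ (K - n)) * ((((F.P K).L : ℝ) ^ (F.P K).d) ^ (K - n))⁻¹ / c₀) = 25 / 8 := by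
    rw [show ((F.P K).L : ℝ) = (F.L : ℝ) from rfl, T3Family.P_d]; field_simp
  have hMraw : 16 * c₀ * ((F.L : ℝ) ^ (K - n)) ^ 3 / (am * (c₀ * ((F.L : ℝ) ^ 3) ^ (K - n))) = 16 / am := by
    rw [← pow_mul, ← pow_mul, Nat.mul_comm]; field_simp
  have hM : max 2 (16 * c₀ * ((F.L : ℝ) ^ (K - n)) ^ 3 / (am * (c₀ * ((F.L : ℝ) ^ 3) ^ (K - n)))) = max 2 (16 / am) := by rw [hMraw]
  have hdEx : 600 * (27 / 4 : ℝ) ^ 6 * ((c₀ * ((F.L : ℝ) ^ 3) ^ (K - n)) / (c₀ * ((F.L : ℝ) ^ 3) ^ (K - n))) = 600 * (27 / 4 : ℝ) ^ 6 := by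
    rw [div_self (by positivity), mul_one]
  have hη : 0 < eta F n K := eta_pos F n K
  have hη1 : eta F n K ≤ 1 := by
    show ((F.L : ℝ)⁻¹) ^ (K - n) ≤ 1
    exact pow_le_one₀ (inv_nonneg.2 hL0.le) (inv_le_one_of_one_le₀ hL1.le)
  -- the closed letters of the LOD mass `am`
  set M' : ℝ := max 2 (16 / am) with hM'def
  have hM'2 : 2 ≤ M' := le_max_left _ _
  set cδ : ℝ := 27 + 2025 / 8 * am with hcδdef
  have hcδ1 : 1 ≤ cδ := by rw [hcδdef]; linarith [ham.le]
  set μ : ℝ := 1 / (10 * Real.sqrt M' * Real.sqrt cδ) with hμdef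
  have hsM1 : 1 ≤ Real.sqrt M' := Real.one_le_sqrt.2 (by linarith)
  have hsc1 : 1 ≤ Real.sqrt cδ := Real.one_le_sqrt.2 hcδ1
  have hμ0 : 0 < μ := by rw [hμdef]; positivity
  have hμ10 : 10 * μ ≤ 1 := by
    rw [hμdef]
    have h1 : (1 : ℝ) ≤ Real.sqrt M' * Real.sqrt cδ := one_le_mul_of_one_le_of_one_le hsM1 hsc1
    rw [show 10 * (1 / (10 * Real.sqrt M' * Real.sqrt cδ)) = 1 / (Real.sqrt M' * Real.sqrt cδ) by field_simp]
    rw [div_le_one (by positivity)]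
    exact h1
  have hμ3 : 3 * μ ≤ 1 := by linarith only [hμ10, hμ0]
  have hμ4 : μ ≤ 1 / 4 := by linarith only [hμ10, hμ0]
  have hminμ : min μ (1 / 4) = μ := min_eq_left hμ4
  set Γ : ℝ := (Real.sqrt (max 2 (16 / am)) * (2 + Real.sqrt (max 2 (16 / am))) * (3 * Real.sqrt 3 + 27 + 9 * Real.sqrt am * Real.sqrt (25 / 8) + 81 * am * (25 / 8))
                * (8 * Real.sqrt (max 2 (16 / am)) + 8 * Real.sqrt (max 2 (16 / am)) ^ 2) * (10 * Real.sqrt (25 / 8)) + 9 * (max 2 (16 / am)) * Real.sqrt (25 / 8)) with hΓdef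
  have hΓ : 0 < Γ := by rw [hΓdef]; positivity
  set mBc : ℝ := (2 / ((1 + 25 / 8) * (600 * (27 / 4 : ℝ) ^ 6 + am))) with hmBcdef
  have hmBc : 0 < mBc := by rw [hmBcdef]; positivity
  set μ' : ℝ := min (μ / 4) (mBc / (3 * Γ)) with hμ'def
  have hμ'0 : 0 < μ' := lt_min (by linarith only [hμ0]) (by positivity)
  have hμ'le : μ' ≤ μ / 4 := min_le_left _ _
  have hμ'lt : μ' < μ := by linarith only [hμ'le, hμ0]
  have hμ'3 : 3 * μ' ≤ 1 := by linarith only [hμ'le, hμ10, hμ0]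
  have hμ'9 : 9 * μ' ≤ 1 := by linarith only [hμ'le, hμ10, hμ0]
  have hμ'Γ' : μ' ≤ mBc / (3 * Γ) := min_le_right _ _
  -- the weight rate `δ₁ = μ′∕2` below both engine rates
  have hδ₁0 : 0 ≤ μ' / 2 := by positivity
  have hδ₁μ' : μ' / 2 < μ' := by linarith only [hμ'0]
  have hδ₁κ : μ' / 2 < min μ (1 / 4) / 2 := by rw [hminμ]; linarith only [hμ'le, hμ0]
  have hs1 : 0 < min μ (1 / 4) / 2 - μ' / 2 := sub_pos.mpr hδ₁κ
  have hs2 : 0 < μ' - μ' / 2 := sub_pos.mpr hδ₁μ'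
  -- the column window at `μ` (EQUALITY in `window_win`) and the column VALUE decay at the pin, leaves closed
  have hδμ := window_delta (a := am) (sx := ((25 / 8) * ((c₀ * ((F.L : ℝ) ^ 3) ^ (K - n)) * ((((F.P K).L : ℝ) ^ (F.P K).d) ^ (K - n))⁻¹ / c₀))) (η := eta F n K) ham hsx hη hη1 hμ0.le hμ3
  have hwinμ := window_win ham hM
  have hcol := hcol_of_massiveColumn_decay F h hε₀ hε7 U₀ hreg Q'' hseq ι hι T hT ham G hAG hμ0 (δ₂ := Real.sqrt cδ * μ) (by positivity) hδμ hwinμ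
  rw [unitA_pin F (n := n) (K := K) hc₀, unitU1_pin F (n := n) (K := K) hc₀ ham, unitU3_pin F (n := n) (K := K) hc₀ ham μ] at hcol
  -- the Gram window at `μ′`
  have hδμ' := window_delta (a := am) (sx := ((25 / 8) * ((c₀ * ((F.L : ℝ) ^ 3) ^ (K - n)) * ((((F.P K).L : ℝ) ^ (F.P K).d) ^ (K - n))⁻¹ / c₀))) (η := eta F n K) ham hsx hη hη1 hμ'0.le hμ'3
  have hwinμ' : Real.sqrt (max 2 (16 * c₀ * ((F.L : ℝ) ^ (K - n)) ^ 3 / (am * (c₀ * ((F.L : ℝ) ^ 3) ^ (K - n))))) * (Real.sqrt cδ * μ') ≤ 1 / 10 := by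
    refine le_trans ?_ hwinμ
    apply mul_le_mul_of_nonneg_left _ (Real.sqrt_nonneg _)
    exact mul_le_mul_of_nonneg_left hμ'lt.le (Real.sqrt_nonneg _)
  -- the gap at `μ′`
  have hG0 := gap_nonneg (a := am) (sx := ((25 / 8) * ((c₀ * ((F.L : ℝ) ^ 3) ^ (K - n)) * ((((F.P K).L : ℝ) ^ (F.P K).d) ^ (K - n))⁻¹ / c₀))) (η := eta F n K)
    (M := max 2 (16 * c₀ * ((F.L : ℝ) ^ (K - n)) ^ 3 / (am * (c₀ * ((F.L : ℝ) ^ 3) ^ (K - n))))) (μ' := μ') ham hη (by positivity) hμ'0.le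
  have hGle := gap_le (a := am) (sx := ((25 / 8) * ((c₀ * ((F.L : ℝ) ^ 3) ^ (K - n)) * ((((F.P K).L : ℝ) ^ (F.P K).d) ^ (K - n))⁻¹ / c₀))) (η := eta F n K)
    (M := max 2 (16 * c₀ * ((F.L : ℝ) ^ (K - n)) ^ 3 / (am * (c₀ * ((F.L : ℝ) ^ 3) ^ (K - n))))) (μ' := μ') ham hsx hη hη1 hM hμ'0.le hμ'3
  obtain ⟨hgap, hP2pos, hP2⟩ := window_gap hG0 hGle hΓ hmBc hμ'Γ'
  have hexp9 : Real.exp (9 * μ') ≤ 3 := exp_nine_mul_le_three hμ'9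
  -- the operator rows at `RegPr`, read at the closed coercivity constant
  have hmBraw : (2 / ((1 + (25 / 8) * ((c₀ * ((F.L : ℝ) ^ 3) ^ (K - n)) * ((((F.P K).L : ℝ) ^ (F.P K).d) ^ (K - n))⁻¹ / c₀)) * (600 * (27 / 4 : ℝ) ^ 6 * ((c₀ * ((F.L : ℝ) ^ 3) ^ (K - n)) / (c₀ * ((F.L : ℝ) ^ 3) ^ (K - n))) + am))) = mBc := by
    rw [hsx, hdEx]
  have hCTb := norm_lift_topMean_le F h hε₀ hε7 U₀ hreg Q'' hseq ι hι
  have hGn := norm_massive_inverse_le F h hε₀ hε7 U₀ hreg Q'' hseq ι hι T hT ham G hAG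
  have hcoer : ∀ f : SiteL2K ℂ 3 (periodsT3 F n) (c₀ * ((F.L : ℝ) ^ 3) ^ (K - n)) W₂, mBc * ‖f‖ ≤ ‖G (T f)‖ := by
    intro f
    have := coarseGram_coercive F hnK h hε₀ hε7 U₀ hreg Q'' hseq ι hι T hT ham G hAG f
    rwa [hmBraw] at this
  -- nonnegativity of the closed column constant
  have hCpt0 : 0 ≤ ((14 * (8 * Real.exp (3 * min μ (1 / 4)) * ((5 / 2 : ℝ) + Real.exp (3 * μ) * ((am * (5 / 2) * (25 / 8) * (8 * max 2 (16 / am))))))) + (Real.sqrt 432 * (Real.sqrt (8 * Real.exp (3 * min μ (1 / 4)) * Real.exp (6 * μ) * (2 * (1 + 1 / μ)) ^ 3) * ((8 * max 2 (16 / am)) * Real.sqrt (25 / 8))))) := by positivity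
  -- (src-κ) at these letters
  have hmain := hsrcW_of_P3v F h hε₀ hε7 U₀ hreg Q'' hseq ι hι T hT ham G hAG hμ'0 (δ₁ := Real.sqrt cδ * μ') (by positivity) hδμ' hwinμ'
    (Real.sqrt_nonneg _) hCTb (by positivity) hGn hmBc hcoer hgap hCpt0 hcol hδ₁0 hδ₁κ hδ₁μ'
  -- monotone bookkeeping of the constant: `(m_B²∕2 − 3ε²)⁻¹ ≤ 6∕m_B²`, `e^{9μ′} ≤ 3`, `A_T·c₀(√c₁)⁻¹ℓ³ = 5∕2`
  have hI0 := (inv_pos.2 hP2pos).le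
  have hAT : 0 ≤ (5 / 4) * Real.sqrt (2 * (c₀ * ((F.L : ℝ) ^ 3) ^ (K - n))) * ((((F.P K).L : ℝ) ^ (F.P K).d) ^ (K - n))⁻¹ / c₀ * (Real.sqrt (2 * (c₀ * ((F.L : ℝ) ^ 3) ^ (K - n))) * (Real.sqrt (c₀ * ((F.L : ℝ) ^ 3) ^ (K - n)))⁻¹) := by positivity
  have hF4 : 0 ≤ 4 * (2 * (1 + 1 / (μ' - μ' / 2))) ^ 3 := by positivity
  have hCc : 0 ≤ c₀ * (Real.sqrt (c₀ * ((F.L : ℝ) ^ 3) ^ (K - n)))⁻¹ * ((14 * (8 * Real.exp (3 * min μ (1 / 4)) * ((5 / 2 : ℝ) + Real.exp (3 * μ) * ((am * (5 / 2) * (25 / 8) * (8 * max 2 (16 / am))))))) + (Real.sqrt 432 * (Real.sqrt (8 * Real.exp (3 * min μ (1 / 4)) * Real.exp (6 * μ) * (2 * (1 + 1 / μ)) ^ 3) * ((8 * max 2 (16 / am)) * Real.sqrt (25 / 8))))) * (((((F.P K).L : ℝ) ^ (F.P K).d) ^ (K - n)) * (2 * (1 + 1 / (min μ (1 / 4) /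 2 - μ' / 2))) ^ 3) := by positivity
  have hmono := sw_le_aux hAT hI0 hP2 (Real.exp_pos _).le hexp9 hF4 hCc
  have hid := AT_mul_Cc_eq (C := ((14 * (8 * Real.exp (3 * min μ (1 / 4)) * ((5 / 2 : ℝ) + Real.exp (3 * μ) * ((am * (5 / 2) * (25 / 8) * (8 * max 2 (16 / am))))))) + (Real.sqrt 432 * (Real.sqrt (8 * Real.exp (3 * min μ (1 / 4)) * Real.exp (6 * μ) * (2 * (1 + 1 / μ)) ^ 3) * ((8 * max 2 (16 / am)) * Real.sqrt (25 / 8))))))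
    (B := (2 * (1 + 1 / (min μ (1 / 4) / 2 - μ' / 2))) ^ 3) hc₀ hc₁ (by positivity : (0:ℝ) < (((F.P K).L : ℝ) ^ (F.P K).d) ^ (K - n))
  intro v z Vb hv x
  have hVb : 0 ≤ Vb := (mul_nonneg_iff_of_pos_right (Real.exp_pos _)).mp ((norm_nonneg _).trans (hv 0))
  have h1 := hmain v z Vb hv x
  refine h1.trans (mul_le_mul_of_nonneg_right (mul_le_mul_of_nonneg_right (hmono.trans (le_of_eq ?_)) hVb) (Real.exp_pos _).le)
  calc 4 * ((5 / 4) * Real.sqrt (2 * (c₀ * ((F.L : ℝ) ^ 3) ^ (K - n))) * ((((F.P K).L : ℝ) ^ (F.P K).d) ^ (K - n))⁻¹ / c₀ * (Real.sqrt (2 * (c₀ * ((F.L : ℝ) ^ 3) ^ (K - n))) * (Real.sqrt (c₀ * ((F.L : ℝ) ^ 3) ^ (K - n)))⁻¹))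
        * (((6 / mBc ^ 2 * 3) * (c₀ * (Real.sqrt (c₀ * ((F.L : ℝ) ^ 3) ^ (K - n)))⁻¹ * ((14 * (8 * Real.exp (3 * min μ (1 / 4)) * ((5 / 2 : ℝ) + Real.exp (3 * μ) * ((am * (5 / 2) * (25 / 8) * (8 * max 2 (16 / am))))))) + (Real.sqrt 432 * (Real.sqrt (8 * Real.exp (3 * min μ (1 / 4)) * Real.exp (6 * μ) * (2 * (1 + 1 / μ)) ^ 3) * ((8 * max 2 (16 / am)) * Real.sqrt (25 / 8))))) * (((((F.P K).L : ℝ) ^ (F.P K).d) ^ (K - n)) * (2 * (1 + 1 / (min μ (1 / 4) / 2 - μ' / 2))) ^ 3))) * (4 * (2 * (1 + 1 / (μ' - μ' / 2))) ^ 3))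
      = 4 * ((6 / mBc ^ 2 * 3) * (4 * (2 * (1 + 1 / (μ' - μ' / 2))) ^ 3)) * ((5 / 4) * Real.sqrt (2 * (c₀ * ((F.L : ℝ) ^ 3) ^ (K - n))) * ((((F.P K).L : ℝ) ^ (F.P K).d) ^ (K - n))⁻¹ / c₀ * (Real.sqrt (2 * (c₀ * ((F.L : ℝ) ^ 3) ^ (K - n))) * (Real.sqrt (c₀ * ((F.L : ℝ) ^ 3) ^ (K - n)))⁻¹)
          * (c₀ * (Real.sqrt (c₀ * ((F.L : ℝ) ^ 3) ^ (K - n)))⁻¹ * ((14 * (8 * Real.exp (3 * min μ (1 / 4)) * ((5 / 2 : ℝ) + Real.exp (3 * μ) * ((am * (5 / 2) * (25 / 8) * (8 * max 2 (16 / am))))))) + (Real.sqrt 432 * (Real.sqrt (8 * Real.exp (3 * min μ (1 / 4)) * Real.exp (6 * μ) * (2 * (1 + 1 / μ)) ^ 3) * ((8 * max 2 (16 / am)) * Real.sqrt (25 / 8))))) * (((((F.P K).L : ℝ) ^ (F.P K).d) ^ (K - n)) * (2 * (1 + 1 / (min μ (1 / 4) / 2 - μ' / 2))) ^ 3))) :=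 by ring
    _ = 4 * ((6 / mBc ^ 2 * 3) * (4 * (2 * (1 + 1 / (μ' - μ' / 2))) ^ 3)) * ((5 / 2) * ((14 * (8 * Real.exp (3 * min μ (1 / 4)) * ((5 / 2 : ℝ) + Real.exp (3 * μ) * ((am * (5 / 2) * (25 / 8) * (8 * max 2 (16 / am))))))) + (Real.sqrt 432 * (Real.sqrt (8 * Real.exp (3 * min μ (1 / 4)) * Real.exp (6 * μ) * (2 * (1 + 1 / μ)) ^ 3) * ((8 * max 2 (16 / am)) * Real.sqrt (25 / 8))))) * (2 * (1 + 1 / (min μ (1 / 4) / 2 - μ' / 2))) ^ 3) := by rw [hid]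
    _ = _ := by rw [hμ'def, hmBcdef, hΓdef, hμdef, hM'def, hcδdef]; ring

end Summit.QuantumFields.YangMills.Theorems.Prop7ComplementarySourceWeightedPin

end
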